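import Summits.ValiantsHypothesis.ValiantsHypothesis.Theses.SymmetroidDescartes
import Summits.ValiantsHypothesis.ValiantsHypothesis.Theorems.SymmetroidDescartesDerivedPencilRolleQuasiStubLoewnerRung

/-!
# Crux `DerivedPencilRolleQuasi` (stmt-ValiantsHypothesis-18064) — line `Sketch`
(ideator-2 skeleton `SketchIdeator2.lean`, owned and reshaped by the line lead)

The line: the crux with `C = 0` follows from the MULTIPLICITY-COUNTED bound `QuasiBoundMult` (C⁺), which
is what every multiplicity-blind technique (Descartes / Rolle / Wronskian / inertia counting) delivers
anyway (`quasiBoundMult_imp_crux`, proved).  Stubs (sorries live ONLY here):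

* `stub_quasiBoundMult : QuasiBoundMult` — the transfer target C⁺ (crux-sized; held by the lead);
* `stub_loewner_rung` — the solved head of card `monotone-freezing`: a SYMMETRIC head `T₀` plus a PSD
  lacunary tail is Loewner-monotone on `(0,∞)`, so `det` has at most `k` distinct positive roots
  (negative-index counting; Courant–Fischer).  Calibration rung — LANDED p161134 (e = 0 case of tree `firstRung_low`).

`DerivedPencilRolleQuasi_of` concludes the crux BY NAME from the stubs.
-/

set_option linter.unusedVariables false
-- single-conjunct layout: Sub = Summit, duplicated namespace component intended
set_option linter.dupNamespace false

namespace Summit.ValiantsHypothesis.ValiantsHypothesis.Cruxes.DerivedPencilRolleQuasi.SketchLine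

open Polynomial Matrix Finset
open scoped BigOperators

/-- The lacunary pencil `Σ_l X^{d_l} • S_l` (verbatim the crux's expression). -/
noncomputable def pencil {K m : ℕ} (d : Fin K → ℕ) (S : Fin K → Matrix (Fin m) (Fin m) ℝ) :
    Matrix (Fin m) (Fin m) ℝ[X] :=
  ∑ l, (X : ℝ[X]) ^ d l • (S l).map C

/-- `Z₊^mult`: positive real roots of `det` of the pencil counted WITH multiplicity. -/
noncomputable def posRootCountMult {K m : ℕ} (d : Fin K → ℕ) (S : Fin K → Matrix (Fin m) (Fin m) ℝ) : ℕ :=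
  Multiset.card ((pencil d S).det.roots.filter (fun t => 0 < t))

/-- **C⁺ (transfer target)**: the crux's budget for positive roots COUNTED WITH MULTIPLICITY (`C = 0`). -/
def QuasiBoundMult : Prop :=
  ∃ A : ℕ, ∀ (m K : ℕ) (S : Fin (K + 1) → Matrix (Fin m) (Fin m) ℝ) (d : Fin (K + 1) → ℕ),
    (∀ l, (S l).IsSymm) → (∀ l, (S l).det ≠ 0) → StrictMono d →
      posRootCountMult d S ≤ (K + 1) ^ (A * K) * 2 ^ (Nat.log 2 m + 2) ^ A

/-! ## Stubs (sorries live ONLY here) -/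

/-- STUB (crux-sized, held by the lead): the multiplicity-counted quasi-polynomial bound C⁺. -/
theorem stub_quasiBoundMult : QuasiBoundMult := by
  sorry

/-- STUB (M, calibration rung of card `monotone-freezing`): a SYMMETRIC head `T₀` plus a positive
semidefinite lacunary tail `Σ_l X^{d_l} • T_l` (`d_l ≥ 1`) is Loewner non-decreasing on `(0,∞)`, hence its
determinant (if not the zero polynomial) has at most `k` distinct positive roots: across each root the
negative index of inertia drops by at least the nullity (Courant–Fischer / Sylvester). -/
theorem stub_loewner_rung (k K : ℕ) (T₀ : Matrix (Fin k) (Fin k) ℝ) (hT₀ : T₀.IsSymm)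
    (T : Fin K → Matrix (Fin k) (Fin k) ℝ) (hT : ∀ l, (T l).PosSemidef) (d : Fin K → ℕ) (hd : ∀ l, 0 < d l)
    (hne : (T₀.map C + ∑ l, (X : ℝ[X]) ^ d l • (T l).map C).det ≠ 0) :
    ((T₀.map C + ∑ l, (X : ℝ[X]) ^ d l • (T l).map C).det.roots.toFinset.filter (fun t => 0 < t)).card ≤ k :=
  -- LANDED (p161134): `Theorems/SymmetroidDescartesDerivedPencilRolleQuasiStubLoewnerRung.lean`
  Summit.ValiantsHypothesis.ValiantsHypothesis.Theorems.SymmetroidDescartes.DerivedPencilRolleQuasiSketch.stub_loewner_rung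
    k K T₀ hT₀ T hT d hd hne

/-! ## Glue (proved) -/

/-- C⁺ ⇒ the crux (with `C = 0`): distinct roots are at most roots with multiplicity. -/
theorem quasiBoundMult_imp_crux (h : QuasiBoundMult) :
    Summit.ValiantsHypothesis.ValiantsHypothesis.Theses.SymmetroidDescartes.DerivedPencilRolleQuasi := by
  obtain ⟨A, hA⟩ := h
  refine ⟨0, A, ?_⟩
  intro m K S d hS hdet hd
  have h1 := hA m K S d hS hdet hd
  have h2 : ((pencil d S).det.roots.toFinset.filter (fun t => 0 < t)).card ≤ posRootCountMult d S := by
    unfold posRootCountMult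
    rw [← Multiset.toFinset_filter]
    exact Multiset.toFinset_card_le _
  have h3 : ((∑ l, (Polynomial.X : Polynomial ℝ) ^ d l • (S l).map Polynomial.C).det.roots.toFinset.filter
      (fun t => 0 < t)).card ≤ (K + 1) ^ (A * K) * 2 ^ (Nat.log 2 m + 2) ^ A := h2.trans h1
  simpa using h3

/-- **The line's composition**: the crux, by name, from the stubs (`stub_loewner_rung` is the line's
calibration rung and is not consumed by the transfer). -/
theorem DerivedPencilRolleQuasi_of :
    Summit.ValiantsHypothesis.ValiantsHypothesis.Theses.SymmetroidDescartes.DerivedPencilRolleQuasi :=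
  quasiBoundMult_imp_crux stub_quasiBoundMult

end Summit.ValiantsHypothesis.ValiantsHypothesis.Cruxes.DerivedPencilRolleQuasi.SketchLine
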